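import Summits.CriticalPhenomena.PercolationContinuityZ3.Theorems.PercNearOneGluingNoHeavyLowerTailFourCopyHubTriC
import HarnessLib

/-! — part 4: the elementwise maximum over hub states, the main bound, the conclusion from the computed check
# `NoHeavyLowerTail` (stmt-CriticalPhenomena-4575) — FOUR-copy switching certificates, VIII: the TRIANGLE bound
# (two-step programs on all pairs of target copies), its soundness, and the `E₃` conclusion from a computed bound

Support file (prover prim-ineq-prove-3 gen 8; `--supports stmt-CriticalPhenomena-4575`).  No named facts, no sorries.

The certificates of gen 6 (referee-verified for all finite graphs in the compute lane) use ALL 72 two-step programs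
`u → T₁ ; v → T₂` (`{T₁,T₂} ⊆ {1,2,3}`), including those with target set `{1,2}`, which couple the two side copies.  For a
weakly well-formed certificate `c` (`Cert.wfT`: no hub condition) the bound of this file is
`VT c πX t₁ t₂ t₃ = max over the refined states s₁ of copy 1 and s₃ of copy 3 of F(s₁,s₃) + Σ_w max_{p ∈ opts(t₂,w)} G_w(p; s₁,s₃)`:
given `s₁` and `s₃`, copy `2` and its `X`-blocks decouple (every program reads at most one root letter of copy `2`).  The
per-source-type tables (`mkTriTabs`) are plain integer tables of `e1`/`e2` (no packing: this bound is meant to be EVALUATED —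
`decide` by compiled evaluation — not reduced by the kernel; ≈ 10⁹ elementary operations for the full certificate).
SOUNDNESS (`Sreal_le_VT`): `Sreal c τ x ≤ VT c (type x₀) (type x₁) (type x₂) (type x₃)`.
CONCLUSION (`e3_nonneg_of_triOK`): if `triOK c E D = true` — the symmetrisation of the cell function
`U = Pc + D·Tc − V` is nonnegative at every sorted cell, `V` the table of all `VT` values — then `E₃(A,B,C) ≥ 0` for the
target events on every finite graph (measure preservation `E[S] = E[Pc]`, `S ≤ V(code)`, `E[U(code)] ≥ 0`).
-/

namespace Summit.CriticalPhenomena.PercolationContinuityZ3.Theorems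

namespace FourCopyHub

open Finset Literature.Probability.Percolation Literature.Probability.Percolation.DecisionTree
open Literature.Probability.Percolation.Gladkov ThreePointLB GroupThreePointLB FourPointAtoms SwitchRelax SwitchingK
open scoped Classical

/-! ### From rows to the bound: the elementwise maximum over hub states -/

section Fold

/-- `15 × 15` shape. [this work] -/
def Shp15 (L : List (List ℤ)) : Prop := L.length = 15 ∧ ∀ r ∈ L, r.length = 15

/-- Auxiliary lemma `shp15_tbot` (see the statement). [this work] -/
theorem shp15_tbot : Shp15 tbot := by
  refine ⟨by simp [tbot, allTys], fun r hr => ?_⟩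
  simp only [tbot, List.mem_map] at hr
  obtain ⟨_, _, rfl⟩ := hr
  simp [allTys]

/-- Auxiliary lemma `shp15_tmax` (see the statement). [this work] -/
theorem shp15_tmax {A B : List (List ℤ)} (hA : Shp15 A) (hB : Shp15 B) : Shp15 (tmax A B) := by
  refine ⟨by rw [tmax, List.length_zipWith, hA.1, hB.1]; rfl, fun r hr => ?_⟩
  unfold tmax at hr
  obtain ⟨i, hi, rfl⟩ := List.getElem_of_mem hr
  rw [List.length_zipWith] at hi
  rw [List.getElem_zipWith, List.length_zipWith, hA.2 _ (List.getElem_mem _), hB.2 _ (List.getElem_mem _)]; rfl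

/-- Auxiliary lemma `shp15_foldr` (see the statement). [this work] -/
theorem shp15_foldr (Ls : List (List (List ℤ))) (h : ∀ L ∈ Ls, Shp15 L) : Shp15 (Ls.foldr tmax tbot) := by
  induction Ls with
  | nil => exact shp15_tbot
  | cons L Ls ih =>
    rw [List.foldr_cons]
    exact shp15_tmax (h L List.mem_cons_self) (ih fun L' hL' => h L' (List.mem_cons_of_mem _ hL'))

/-- Entry of `tmax`. [this work] -/
theorem lk_tmax {A B : List (List ℤ)} (hA : Shp15 A) (hB : Shp15 B) {i j : ℕ} (hi : i < 15) (hj : j < 15) :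
    lk (lk (tmax A B) i []) j bot = max (lk (lk A i []) j bot) (lk (lk B i []) j bot) := by
  have hiA : i < A.length := by rw [hA.1]; exact hi
  have hiB : i < B.length := by rw [hB.1]; exact hi
  have hjA : j < (A[i]'hiA).length := by rw [hA.2 _ (List.getElem_mem _)]; exact hj
  have hjB : j < (B[i]'hiB).length := by rw [hB.2 _ (List.getElem_mem _)]; exact hj
  simp only [lk, tmax, List.getElem?_zipWith, List.getElem?_eq_getElem hiA, List.getElem?_eq_getElem hiB,
    Option.getD_some, List.getElem?_eq_getElem hjA, List.getElem?_eq_getElem hjB]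

/-- **Every member table is dominated entrywise by the folded maximum.** [this work] -/
theorem lk_le_foldr_tmax (Ls : List (List (List ℤ))) (h : ∀ L ∈ Ls, Shp15 L) {M : List (List ℤ)} (hM : M ∈ Ls)
    {i j : ℕ} (hi : i < 15) (hj : j < 15) : lk (lk M i []) j bot ≤ lk (lk (Ls.foldr tmax tbot) i []) j bot := by
  induction Ls with
  | nil => exact absurd hM List.not_mem_nil
  | cons L Ls ih =>
    have hL : Shp15 L := h L List.mem_cons_self
    have hLs : ∀ L' ∈ Ls, Shp15 L' := fun L' hL' => h L' (List.mem_cons_of_mem _ hL')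
    rw [List.foldr_cons, lk_tmax hL (shp15_foldr Ls hLs) hi hj]
    rcases List.mem_cons.1 hM with rfl | hM'
    · exact le_max_left _ _
    · exact le_trans (ih hLs hM') (le_max_right _ _)

/-- Rows have the shape. [this work] -/
theorem shp15_triRows (c : Cert) (P : TriTabs) (OT : List (List (List Ty))) (t3 : Ty) (Hall : List (List (List (List (Array (Array ℤ))))))
    (O1 O2 : Array (Array (Array ℤ))) (s3 : St4) : Shp15 (triRows c P OT t3 Hall O1 O2 s3) := by
  rw [triRows, triRowsAux]
  refine ⟨by simp [allTys], fun r hr => ?_⟩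
  simp only [List.mem_map] at hr
  obtain ⟨_, _, rfl⟩ := hr
  simp [allTys]

end Fold

section MainBound

variable {V : Type*} [Fintype V] [DecidableEq V] (τ : Fin 4 → V) {c : Cert} (x : Fin 4 → Finset (Sym2 V))

/-- **MAIN BOUND.**  The real value is at most the triangle bound at the real types. [this work] -/
theorem Sreal_le_VT (hw : c.wfT = true) (hcl : c.clsOK = true) :
    Sreal τ c x ≤ VT c (ftype τ (x 0)) (ftype τ (x 1)) (ftype τ (x 2)) (ftype τ (x 3)) := by
  have hA := cls2_lt_nA hcl
  set πX := ftype τ (x 0)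
  set t1 := ftype τ (x 1)
  set t2 := ftype τ (x 2)
  set t3 := ftype τ (x 3)
  set P := mkTriTabs c πX
  have h1 : ∀ u, st τ x 1 u ∈ optsF πX t1 u := fun u => st_mem_optsF τ x 1 u
  have h2 : ∀ w, st τ x 2 w ∈ optsF πX t2 w := fun w => st_mem_optsF τ x 2 w
  have hs3 : st τ x 3 ∈ states πX t3 := proj_realSt4_mem_states τ (x 0) (x 3)
  have step1 := Sreal_le_specVal τ x hw hcl
  have step2 := specVal_le_row hA P πX t1 t2 t3 (st τ x 3) h1 h2
  have step3 := lk_le_foldr_tmax (((states πX t3).map fun s3 =>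
      triRows c P (mkOT πX) t3 (triHall c P (mkOT πX) t3) (triO1 c P t3) (triO2 c P t3) s3))
    (fun L hL => by obtain ⟨s3, _, rfl⟩ := List.mem_map.1 hL; exact shp15_triRows _ _ _ _ _ _ _ _)
    (List.mem_map.2 ⟨st τ x 3, hs3, rfl⟩) t1.isLt t2.isLt
  have e : VT c πX t1 t2 t3 = lk (lk ((((states πX t3).map fun s3 =>
      triRows c P (mkOT πX) t3 (triHall c P (mkOT πX) t3) (triO1 c P t3) (triO2 c P t3) s3)).foldr tmax tbot)
      t1.val []) t2.val bot := by
    rw [VT, VTall, VTallP, lk_map_allTys, triT3, triT3Aux]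
  rw [e]
  exact step1.trans (step2.trans step3)

end MainBound

/-! ### The conclusion from the computed check -/

/-- What `triOK` certifies: the symmetrisation of `U` is nonnegative everywhere. [this work] -/
theorem symS_nonneg_of_triOK {c : Cert} {E : E3Target} {Dsc : ℕ} (h : triOK c E Dsc = true) (o : St4) :
    0 ≤ symS (Ucell c E Dsc (V4 c)) o := by
  refine symS_nonneg_of_sorted _ (fun s hs => ?_) o
  rw [triOK] at h
  simp only [triOKV, List.all_eq_true, decide_eq_true_iff, List.mem_filter] at h
  simp only [srt, Bool.and_eq_true, decide_eq_true_iff] at hs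
  have e : mk4 (s 0) (s 1) (s 2) (s 3) = s := by funext i; fin_cases i <;> rfl
  rw [← e]
  exact h (s 0) (mem_allTys _) (s 1) ⟨mem_allTys _, hs.1.1⟩ (s 2) ⟨mem_allTys _, hs.1.2⟩ (s 3) ⟨mem_allTys _, hs.2⟩

section Expect

variable {V : Type*} [Fintype V] [DecidableEq V] (τ : Fin 4 → V) (D : Finset (Sym2 V))

omit [DecidableEq V] in
/-- The value table read at the code of a configuration is `VT`. [this work] -/
theorem lkV_V4 (c : Cert) (x : Fin 4 → Finset (Sym2 V)) :
    lkV (V4 c) (fun j => ftype τ (x j)) = VT c (ftype τ (x 0)) (ftype τ (x 1)) (ftype τ (x 2)) (ftype τ (x 3)) := by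
  rw [lkV, V4, lk_map_allTys, VT]

/-- **THE CONCLUSION FROM THE COMPUTED CHECK.**  A weakly well-formed certificate with class indices in range whose
check `triOK c E D` evaluates to `true` proves `E₃(A,B,C) ≥ 0` for the target events on every finite graph, every
placement of the four terminals and all coordinate probabilities in `[0,1]`. [this work] -/
theorem e3_nonneg_of_triOK (c : Cert) (E : E3Target) (Dsc : ℕ) (hD : 0 < Dsc) (hw : c.wfT = true) (hcl : c.clsOK = true)
    (hok : triOK c E Dsc = true) {p : Sym2 V → ℝ} (hp0 : ∀ e, 0 ≤ p e) (hp1 : ∀ e, p e ≤ 1) :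
    0 ≤ 2 * PrW D p (evT τ fun t => E.EA t && E.EB t && E.EC t) +
        PrW D p (evT τ E.EA) * PrW D p (evT τ E.EB) * PrW D p (evT τ E.EC) -
        PrW D p (evT τ E.EA) * PrW D p (evT τ fun t => E.EB t && E.EC t) -
        PrW D p (evT τ E.EB) * PrW D p (evT τ fun t => E.EA t && E.EC t) -
        PrW D p (evT τ E.EC) * PrW D p (evT τ fun t => E.EA t && E.EB t) := by
  -- pointwise: S ≤ V(code)
  have hpt : ∀ x : Fin 4 → Finset (Sym2 V), (Sreal τ c x : ℝ) ≤ (lkV (V4 c) (fun j => ftype τ (x j)) : ℝ) := fun x => by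
    rw [lkV_V4]; exact_mod_cast Sreal_le_VT τ x hw hcl
  have hSV : ∑ x ∈ tuplesK D 4, wtKW D p x * (Sreal τ c x : ℝ) ≤
      ∑ x ∈ tuplesK D 4, wtKW D p x * (lkV (V4 c) (fun j => ftype τ (x j)) : ℝ) :=
    Finset.sum_le_sum fun x _ => mul_le_mul_of_nonneg_left (hpt x) (wtKW_nonneg D hp0 hp1 x)
  rw [sum_wtKW_Sreal τ D p c hw] at hSV
  -- E[U(code)] ≥ 0
  have hU := sum_wtKW_nonneg_of_symS τ D (Ucell c E Dsc (V4 c)) (symS_nonneg_of_triOK hok) hp0 hp1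
  have eU : ∀ x : Fin 4 → Finset (Sym2 V), (Ucell c E Dsc (V4 c) (fun j => ftype τ (x j)) : ℝ) =
      (Pc c (fun j => ftype τ (x j)) : ℝ) + Dsc * (Tc E (ftype τ (x 1)) (ftype τ (x 2)) (ftype τ (x 3)) : ℝ)
        - (lkV (V4 c) (fun j => ftype τ (x j)) : ℝ) := fun x => by
    simp only [Ucell, Int.cast_sub, Int.cast_add, Int.cast_mul, Int.cast_natCast]
  simp only [eU, mul_add, mul_sub, Finset.sum_add_distrib, Finset.sum_sub_distrib] at hU
  have hT : ∑ x ∈ tuplesK D 4, wtKW D p x * (Dsc * (Tc E (ftype τ (x 1)) (ftype τ (x 2)) (ftype τ (x 3)) : ℝ)) =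
      Dsc * ∑ x ∈ tuplesK D 4, wtKW D p x * (Tc E (ftype τ (x 1)) (ftype τ (x 2)) (ftype τ (x 3)) : ℝ) := by
    rw [Finset.mul_sum]; exact Finset.sum_congr rfl fun x _ => by ring
  rw [hT, sum_wtKW_Tc] at hU
  have hD' : (0 : ℝ) < Dsc := by exact_mod_cast hD
  nlinarith
  
end Expect

end FourCopyHub

end Summit.CriticalPhenomena.PercolationContinuityZ3.Theorems
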